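import Summits.BirchSwinnertonDyer.BirchSwinnertonDyer.Theorems.ClassRecordThreeHalvesAtThreeBDPValue
import Summits.BirchSwinnertonDyer.Rank1Residual.X11b.Three.BDPExistsGlue
import HarnessLib

/-!
# Route `ClassRecordThree` (rung K2@3) — PROOF-BDP's COROLLARY C.6 in the kernel: modulo THEOREM C typed,
# the leaf `X11b.MultiplicativeRankOneAtThree` follows from the route's items WITHOUT `HsiehDescentAtThree`

Cell `bsd-stepL` (run/shared/lean/pub/bsd-stepL/), seat `bsd-stepL-thmc-p1` (prover g0, D-0074 hands, 2026-08-26),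
`--supports stmt-BirchSwinnertonDyer-19107` (helper). Sequel of `Theorems/ClassRecordThreeHalvesAtThreeBDPValue.lean`
(p417380), whose inline hypothesis `hC` — THEOREM C of the cell at `p = 3` TYPED, i.e. the binder `h12` of
`Three.bdpValueAt₃_of_frameValue` quantified over every curve — this file keeps verbatim.

## What this file records in the kernel

1. `bdpExistsAt₃_of_classicalFrameValue` — **THEOREM C typed ⟹ H1** (`Three.BDPExistsAt₃ W`, the ∃-frame
   existence of a BDP anticyclotomic 3-adic L-function at `3 ∥ N`) for every `W`: forget the value conjunct; SOME
   `ι' : ℚ̄₃ ≃ ℂ` inducing `𝔭` exists (`Three.exists_inducesPrime'`, X11b/Three/BDPExistsGlue.lean). This is PROOF-BDP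
   §20.5 COROLLARY C.6 («THEOREM C (i) alone exhibits an R₀-frame at 3 ‖ N — the conclusion Theorem A reaches by
   Galois descent … with NO descent»; HOME `bdp/TheoremC_Typed.lean` has the same one-liner over its HOME-only def).
2. `classRecordThree_threeHalves_of_classicalFrameValue_of_imcDivStub` — modulo THEOREM C typed, the road-(b) ∕
   road-(d) binders of the CLASS RECORD OF RECORD v4.3 (`Three.forall_bsdp_of_classRecord_v43`,
   X11b/Three/ClassRecordHalves.lean: `… → BDPExistsAt₃ W ∧ BDPValueAt₃ W ∧ IMCDivAt₃ W` per locus) follow from H3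
   alone (the registered stub `stub_imcDivAtThree` of item 19107).
3. `multiplicativeRankOneAtThree_of_classicalFrameValue_of_imcDivStub` — **the rung-K2@3 leaf from THEOREM C typed
   + `SchneiderAtThree` + H3 (two-loci stub shape) + `EulerHalvesAtThree` + `ShimuraDisplaysAtThree` +
   `CornerAtThree` + `PublishedInputsThree`, WITHOUT `HsiehDescentAtThree`** — through v4.3 (NOT v4.5′: v4.5′ routes
   H1 through Hsieh 2014 Thm. 1 + the descent residual `Three.HsiehDescentAt₃`; v4.3 takes the three halves
   directly), with v4.3's `hEP` binder discharged by the tree theorem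
   `GaloisImage.EP.localEulerPoincareCharacteristic_adicCompletion` exactly as v4.5′ does; the support's 20th
   conjunct (Hsieh 2014 Thm. 1) is not used.
4. `classRecordThree_closes_of_classicalFrameValue_without_hsiehDescent` — the same with the route's own item
   `HalvesAtThree` in place of the H3 stub: modulo THEOREM C typed, `SchneiderAtThree → HalvesAtThree →
   EulerHalvesAtThree → ShimuraDisplaysAtThree → CornerAtThree → PublishedInputsThree → X11b.MultiplicativeRankOneAtThree`
   — the route's `Assembly` with its third hypothesis `HsiehDescentAtThree` (item 19108) DELETED.

READING (for the planner ∕ director; nothing is booked): THEOREM C typed is ALREADY the price of the H2 half of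
`HalvesAtThree` (item 19107; no other producer of `Three.BDPValueAt₃` exists in the tree); this file shows it ALSO
pays for H1@3, so that — modulo that ONE refereed memo theorem — crux 4 `HsiehDescentAtThree` (item 19108, kernel
price {`TateSenCharacterVanishing 3` (p414875) + K5-B value reciprocity}) is not needed for the leaf. Whether the
route should carry C.6 (one memo theorem on the Katz-measure front) instead of Theorem A's descent (print fact + K5-B
on the CM-period front) is the planner's ∕ director's call (PROOF-BDP §20.5: «offered, NOT replacing Theorem A's
record»); both inputs are memo-level today.

HONEST FRAMING: every theorem here is an implication; THEOREM C is a refereed MEMO theorem (VERDICT-THMC-g7; C♯ g19 ∕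
g21), NOT a kernel theorem and not a Literature fact; H3 at `p = 3`, `SchneiderAtThree`, the (T2′)₃ ∕ Shimura ∕
corner inputs stay hypotheses. Nothing is discharged; no node, label or census count moves (T7); O2 stays OPEN;
BSD is not proved for any class by this file.

References: [Castella2018] Camb. J. Math. 6 (2018) = arXiv:1704.06608, Thm. 2.3 (p. 5), Thm. 3.1–3.3 (pp. 8–9),
§5 (p. 12); [CastellaHsieh2018] Math. Ann. 370, §3.3, Prop. 3.6; [KrizLi2019] Forum Math. Sigma 7 e15 §2;
[LiuZhangZhang2018] Duke 167, App. A; [Hsieh2014] Doc. Math. 19, Thm. 1; cell memo PROOF-BDP §20.5 (C.6);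
tree X11b/Three/ClassRecordHalves.lean (v4.3, p261173), ClassRecordEP.lean (v4.5′), RungK2Leaves.lean (leaf).
-/

noncomputable section

open scoped Classical Topology

open Filter WeierstrassCurve NumberField IsDedekindDomain Field PowerSeries
  Literature.NumberTheory.EllipticCurves Literature.NumberTheory.EllipticCurves.ModularForms
  Literature.NumberTheory.EllipticCurves.Rank1Residual
  Literature.NumberTheory.GaloisRepresentations Literature.NumberTheory.GaloisCohomology
  Summit.BirchSwinnertonDyer.Rank1Residual Summit.BirchSwinnertonDyer.Rank1Residual.X11b
  Summit.BirchSwinnertonDyer.Rank1Residual.X11b.AcSelmer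
  Summit.BirchSwinnertonDyer.Rank1Residual.X11b.CongruenceLimit
  Summit.BirchSwinnertonDyer.Rank1Residual.X11b.Halves
  Summit.BirchSwinnertonDyer.Rank1Residual.X11b.Three
  Summit.BirchSwinnertonDyer.BirchSwinnertonDyer.Theses.ClassRecordThree

namespace Summit.BirchSwinnertonDyer.BirchSwinnertonDyer.Theorems

section TheoremC

/- THEOREM C of the cell at `p = 3`, TYPED = the binder `h12` of `Three.bdpValueAt₃_of_frameValue` verbatim, ∀ W
(same text as in `ClassRecordThreeHalvesAtThreeBDPValue.lean`; INLINE hypothesis, no definition). Memo-proved and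
refereed; NOT a kernel theorem: everything in this section is conditional on it. -/
variable
  (hC : ∀ (W : WeierstrassCurve ℚ) [W.IsElliptic] [W.IsGloballyMinimal],
    ∀ (N : ℕ) [NeZero N] (K : Type) [Field K] [NumberField K] (Dt : ModularParametrizationData W N)
    (H : HeegnerDatum N (NumberField.discr K)) (ι : K →+* ℂ) (P : (W.baseChange K).toAffine.Point),
    ClassX11b W 3 → Surj W 3 → W.conductorNorm ℤ = N → IsImaginaryQuadratic K →
    Odd (NumberField.discr K) → SatisfiesHeegnerHypothesis N K →
    (W.quadraticTwist (NumberField.discr K : ℚ)).entireLFunction 1 ≠ 0 →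
    WeierstrassCurve.Affine.Point.map ι.toRatAlgHom P = heegnerPointComplex Dt H →
    ¬ (3 : ℤ) ∣ Dt.c → ¬ IsOfFinAddOrder P →
    ∀ (κ : ZpExtension K 3), κ.IsAnticyclotomic →
      ∀ (γ : Field.absoluteGaloisGroup K) [Fact (κ.IsTopGenerator γ)]
        (𝔭 : HeightOneSpectrum (𝓞 K)) (h𝔭 : ((3 : ℕ) : 𝓞 K) ∈ 𝔭.asIdeal)
        (he : 𝔭.asIdeal.ramificationIdx (𝓞 ℚ) = 1) (hf : 𝔭.asIdeal.inertiaDeg (𝓞 ℚ) = 1),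
        ∀ (f : CuspForm (CongruenceSubgroup.Gamma0 N) 2), IsNewformOf W f →
          ∀ (ι' : PadicAlgCl 3 ≃+* ℂ), InducesPrime ι' 𝔭 →
            ∃ (ΩK : ℂ) (Ωp : (unrIntegers 3)ˣ) (L : UnrSeries 3),
              ΩK ≠ 0 ∧ IsBDPLFunction ι' 𝔭 κ γ f ΩK ((Ωp : unrIntegers 3) : ℂ_[3]) L ∧
              ∃ u : (unrIntegers 3)ˣ, L.HasValueAt 0 (((u : unrIntegers 3) : ℂ_[3]) *
                (algebraMap ℚ_[3] ℂ_[3] (((1 : ℚ_[3]) - ((W.LFunction 3 : ℤ) : ℚ_[3]) * (3 : ℚ_[3])⁻¹) *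
                  logOmega W 3 (embAt K 3 𝔭 h𝔭 he hf) P)) ^ 2))

include hC in
/-- **COROLLARY C.6 — THEOREM C typed ⟹ H1 `Three.BDPExistsAt₃ W` for every curve** (the ∃-frame: SOME `ι'`
inducing `𝔭` and ONE frame `(Ω_K ≠ 0, Ω_p ∈ R₀ˣ, L)` with Castella's interpolation property at `3 ∥ N`): drop the
value conjunct of THEOREM C; a datum `ι'` inducing `𝔭` exists for every prime `𝔭 ∋ 3` of an imaginary quadratic
field (`Three.exists_inducesPrime'`). Descent-free: neither Hsieh's frame nor `Three.HsiehDescentAt₃` enters.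
[cite: Castella2018, Thm. 3.1 (arXiv:1704.06608 p. 9) (shape only; antecedent = PROOF-BDP §20 THEOREM C, Cor. C.6)] -/
theorem bdpExistsAt₃_of_classicalFrameValue (W : WeierstrassCurve ℚ) [W.IsElliptic] [W.IsGloballyMinimal] :
    BDPExistsAt₃ W := by
  intro N _ K _ _ Dt H ι P hX hsurj hN hK hodd hH hL1 hP hc hP0 κ hκ γ _ 𝔭 h𝔭 he hf f hnf
  obtain ⟨ι', hι'⟩ := exists_inducesPrime' hK h𝔭
  obtain ⟨ΩK, Ωp, L, hΩ, hL, -⟩ :=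
    hC W N K Dt H ι P hX hsurj hN hK hodd hH hL1 hP hc hP0 κ hκ γ 𝔭 h𝔭 he hf f hnf ι' hι'
  exact ⟨ι', hι', ΩK, Ωp, L, hΩ, hL⟩

include hC in
/-- **Modulo THEOREM C typed, the three HALVES of the class record v4.3 on both loci follow from H3 alone**: the
road-(b) binder `hHb` ((ram) ∧ 3 split) and the road-(d) binder `hHd` (¬(ram) ∧ surj) of
`Three.forall_bsdp_of_classRecord_v43` — `BDPExistsAt₃ W ∧ BDPValueAt₃ W ∧ IMCDivAt₃ W` — from the two-loci H3
statement (verbatim the registered stub `stub_imcDivAtThree` of item 19107). H1 and H2 by THEOREM C (C.6 and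
`bdpValueAt₃_of_classicalFrameValue`); H3 is OPEN and passed through.
[cite: Castella2018, Thm. 3.1–3.3 (arXiv:1704.06608 pp. 8–9) (shapes only; nothing asserted)] -/
theorem classRecordThree_threeHalves_of_classicalFrameValue_of_imcDivStub
    (h3 : ∀ (W : WeierstrassCurve ℚ) [W.IsElliptic] [W.IsGloballyMinimal], ClassX11b W 3 →
      (Ram W 3 → W.HasSplitMultiplicativeReductionAtPrime 3 → IMCDivAt₃ W) ∧
        (¬ Ram W 3 → Surj W 3 → IMCDivAt₃ W)) :
    (∀ (W : WeierstrassCurve ℚ) [W.IsElliptic] [W.IsGloballyMinimal],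
      ClassX11b W 3 → Ram W 3 → W.HasSplitMultiplicativeReductionAtPrime 3 →
        BDPExistsAt₃ W ∧ BDPValueAt₃ W ∧ IMCDivAt₃ W) ∧
    (∀ (W : WeierstrassCurve ℚ) [W.IsElliptic] [W.IsGloballyMinimal],
      ClassX11b W 3 → ¬ Ram W 3 → Surj W 3 → BDPExistsAt₃ W ∧ BDPValueAt₃ W ∧ IMCDivAt₃ W) :=
  ⟨fun W _ _ hX hr hs ↦
      ⟨bdpExistsAt₃_of_classicalFrameValue hC W, bdpValueAt₃_of_classicalFrameValue hC W, (h3 W hX).1 hr hs⟩,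
    fun W _ _ hX hnr hsu ↦
      ⟨bdpExistsAt₃_of_classicalFrameValue hC W, bdpValueAt₃_of_classicalFrameValue hC W,
        (h3 W hX).2 hnr hsu⟩⟩

include hC in
/-- **The rung-K2@3 leaf WITHOUT `HsiehDescentAtThree`, modulo THEOREM C typed.** From THEOREM C typed (`hC`),
the route's cruxes `SchneiderAtThree` (road (a)), H3 in the two-loci stub shape (`stub_imcDivAtThree` of item 19107),
`EulerHalvesAtThree`, `ShimuraDisplaysAtThree`, `CornerAtThree` and the support `PublishedInputsThree` (its Hsieh
2014 conjunct unused), the leaf `X11b.MultiplicativeRankOneAtThree` (BSD(E,3) on all of class X11b at 3) follows —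
through the class record OF RECORD v4.3 `Three.forall_bsdp_of_classRecord_v43` (the three halves per road, no descent
binder), `hEP` discharged by `GaloisImage.EP.localEulerPoincareCharacteristic_adicCompletion` as in v4.5′.
CONDITIONAL on every listed hypothesis; closes nothing by itself.
[cite: Castella2018, §5 (arXiv:1704.06608 p. 12) (assembly shape at p ∣ N; inputs typed, not asserted)] -/
theorem multiplicativeRankOneAtThree_of_classicalFrameValue_of_imcDivStub
    (h₁ : SchneiderAtThree)
    (h3 : ∀ (W : WeierstrassCurve ℚ) [W.IsElliptic] [W.IsGloballyMinimal], ClassX11b W 3 →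
      (Ram W 3 → W.HasSplitMultiplicativeReductionAtPrime 3 → IMCDivAt₃ W) ∧
        (¬ Ram W 3 → Surj W 3 → IMCDivAt₃ W))
    (h₄ : EulerHalvesAtThree) (h₅ : ShimuraDisplaysAtThree) (h₆ : CornerAtThree)
    (h₇ : PublishedInputsThree) :
    Summit.BirchSwinnertonDyer.Rank1Residual.X11b.MultiplicativeRankOneAtThree := by
  obtain ⟨hGZ, hKo, hB, hSk, hWu, hGZK, hmod, hnf, hHL, hMaz, hPT, hFH, hBR, hSkA, hJn, hHn, hD,
    hpar, hMN, -⟩ := h₇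
  obtain ⟨hHb, hHd⟩ := classRecordThree_threeHalves_of_classicalFrameValue_of_imcDivStub hC h3
  rw [multiplicativeRankOneAtThree_iff]
  intro W _ _ hX
  exact forall_bsdp_of_classRecord_v43 hGZ hKo hB hSk hWu hGZK hmod hnf hHL hMaz hPT
    GaloisImage.EP.localEulerPoincareCharacteristic_adicCompletion hFH hBR hSkA hJn hHn hD hpar hMN
    h₁ hHb h₅ (fun W _ _ hX ↦ (h₄ W hX).1) (fun W _ _ hX ↦ (h₄ W hX).2.1) hHd
    (fun W _ _ hX ↦ (h₄ W hX).2.2) (fun W _ _ ↦ (h₆ W).1) (fun W _ _ ↦ (h₆ W).2.1)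
    (fun W _ _ ↦ (h₆ W).2.2) W hX

include hC in
/-- **The route's Assembly with `HsiehDescentAtThree` DELETED, modulo THEOREM C typed**: `SchneiderAtThree →
HalvesAtThree → EulerHalvesAtThree → ShimuraDisplaysAtThree → CornerAtThree → PublishedInputsThree →
X11b.MultiplicativeRankOneAtThree` (compare `ClassRecordThree.Assembly`, whose third hypothesis is
`HsiehDescentAtThree`). H3 is read off `HalvesAtThree`; H1 and H2 come from THEOREM C (C.6). PROOF-BDP §20.5
COROLLARY C.6 in kernel form; the planner decides whether the route takes it (TARGET §1.1 H1@3). CONDITIONAL;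
closes nothing by itself. [cite: Castella2018, §5 (arXiv:1704.06608 p. 12) (assembly shape at p ∣ N)] -/
theorem classRecordThree_closes_of_classicalFrameValue_without_hsiehDescent
    (h₁ : SchneiderAtThree) (h₂ : HalvesAtThree) (h₄ : EulerHalvesAtThree) (h₅ : ShimuraDisplaysAtThree)
    (h₆ : CornerAtThree) (h₇ : PublishedInputsThree) :
    Summit.BirchSwinnertonDyer.Rank1Residual.X11b.MultiplicativeRankOneAtThree :=
  multiplicativeRankOneAtThree_of_classicalFrameValue_of_imcDivStub hC h₁
    (fun W _ _ hX ↦ ⟨fun hr hs ↦ ((h₂ W hX).1 hr hs).2, fun hnr hsu ↦ ((h₂ W hX).2 hnr hsu).2⟩)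
    h₄ h₅ h₆ h₇

end TheoremC

end Summit.BirchSwinnertonDyer.BirchSwinnertonDyer.Theorems

end
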